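/-
Copyright (c) 2026 the pub-hodgecm-mathlib formalisation cell (harness21).  Prover seat hodgecm-mathlib-LH4-p11 (g9), req620 Track A «(D-RAM) FOUR-FRAME» squad, helper lane on
h413 = stmt-HodgeConjecture-24833 (count-neutral).  β-BOARD v1 ROW R6 «SPECIAL κ-CLASSES», step B1′ of LH4-p08 (g10)'s tower-3 pipeline (16:04:50Z ask): the FOOT clone of LH7-p06 (g0)'s
★ p861675 (β1) `labelledOddCount_div_relIndex_twoSlot_latt_G3` — proof = theirs token for token with the tube letters replaced by ★ p861570's foot letters (credited).  2026-09-04.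
-/
import Summits.HodgeConjecture.HodgeConjecture.Theorems.F0P3cDyRamLabelledOddBoundaryValueG3     -- ★ p861675 (LH7-p06 (g0), (β1)): `normSign_one_add_mul_mul`; brings ★ p861535 `linear_eq_sum_mul_one_add`, ★ p861456, ★ p860316, ★ conductor toolkit, ★ p861251
import Summits.HodgeConjecture.HodgeConjecture.Theorems.F0P3cDyRamLabelledOddKappaClassLatticeG3  -- ★ p861570 (this seat): `twoSlotLabel_latt_G3_foot`
import HarnessLib

/-!
# Crux `H413`, line LH4 «(D-RAM) FOUR-FRAME» — (β-BAL) Stage B, β-BOARD ROW R6 «SPECIAL κ-CLASSES» (tower 3), step B1′: the labelled odd VALUE of a G₃ normal form AT THE FOOT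
# `2ρ + ℓ₀ = n₁`, in abstract-indicator form — the foot clone of ★ (β1)

Cell `hodgecm-mathlib` (D-0151), FLOOR 0, crux item H413 = `stmt-HodgeConjecture-24833`, route `HCCMUnconditional`; squad F0∕P3c∕LH4.  THEOREMS ONLY (no `def`, no instance, no
notation, no `sorry`, default heartbeats); ★-only imports; lane `--supports stmt-HodgeConjecture-24833 --as helper` (count-neutral); pays NO row, states NO law.
WHAT.  ★ p861675 `labelledOddCount_div_relIndex_twoSlot_latt_G3` (LH7-p06 (g0)) evaluates the per-lattice labelled odd value on the G₃ normal form on the capped TUBE (`2ρ + ℓ₀ + 1 ≤ n₁`,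
read `2ρ + s + ℓ₀ = n₃`) through ★ p861456's character head, with the label in the class-sign shape `ω(S)·ω(u₀)·ω(1 + (u₁∕u₀ − 1)·c)`, `c = G₁∕S`.  The κ-CLASSES of the special
tower 3 sit ONE STEP BELOW (`2ρ + ℓ₀ = n₁`, below the read); there the label has the SAME letter (★ p861570 `twoSlotLabel_latt_G3_foot`), `S` is again a fixed unit — now led by the
Gram term `π₀^{k₁}e_B(D₀ + σxD₁x)` (★ `v_gram_cancel_latt_G3_eq`), the `e_C` term being the twist — and `|c| = |G₁| = exp s`, so ★ `normSign_one_add_mul_mul`'s depth condition at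
`r = ρ + s` reads `|ϖ|^{2ρ} ≤ |ϖ|^{2d−1}`, i.e. `2ρ ≥ 2d − 1`, in force (`2ρ + ℓ₀ = n₁ ≥ N₀ ≥ mcOfRecord d`).  HEAD **`labelledOddCount_div_relIndex_twoSlot_latt_G3_foot`**: the (β1)
conclusion VERBATIM under the foot hypotheses `(hlt : 2ρ + s < 2k₃) (hfoot : 2ρ + ℓ₀ = n₁)`.  Consumer: LH4-p08 (g10)'s B4 «THE κ-CLASS ROW» (∘ ★ p861621 cut = stratum ∘ LH4-p18's orbit
decomposition ∘ g-sums ∘ ★ p861700 line total); the indicators at the foot are NOT all `1` (LH4-p08 erratum 15:57Z: slots 0∕1 `[ρ′ ≥ 2d]`, slot 2 `[ρ′ + v(2−τ) ≥ 2d]`).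
HONEST LABEL.  Count-neutral (`--supports`); nothing printed is asserted; the indicator evaluation, the orbit∕stratum∕family sums (R6b), hRest, (β) `stub_law_cleanSgn`, T₊ remain OPEN;
`HC_CM` is proved only modulo the 7 printed citations (2 remaining named inputs: hLiu418 = `stmt-HodgeConjecture-24832`, h413 = `stmt-HodgeConjecture-24833`) until rung 0 closes.
References: [Kottwitz1986BaseChangeUnits] §1 pp. 240–241 · [Rogawski1990] §4.9 Prop. 4.9.1 (a)(b) p. 55, §4.10 p. 58 · [LanglandsShelstad1987] §3 · [Serre1979] Ch. V §3 Cor. 3 ·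
[Jacobowitz1962] §4, §7.
-/

set_option autoImplicit false

noncomputable section

namespace Summit.HodgeConjecture.HodgeConjecture.Cruxes.H413.F0P3cDyRamLabelledOddKappaClassValueG3

open Literature.NumberTheory.Automorphic Literature.NumberTheory.Automorphic.HermitianLattice
open Literature.NumberTheory.Automorphic.UnitaryLatticeTree Literature.NumberTheory.Automorphic.UnitaryThreeFourFrame
open Literature.NumberTheory.LocalFields Literature.NumberTheory.LocalFields.WildQuadraticDatum
open Summit.HodgeConjecture.HodgeConjecture.Cruxes.H413.F0P3cDyRamFourFramePieces
open Summit.HodgeConjecture.HodgeConjecture.Cruxes.H413.F0P3cDyRamFourFrameCensusDefs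
open Summit.HodgeConjecture.HodgeConjecture.Cruxes.H413.F0P3cDyRamStageOneBDefs (mcOfRecord)
open Summit.HodgeConjecture.HodgeConjecture.Cruxes.H413.F0P3cDyRamDiagonalTorusDefs
open Summit.HodgeConjecture.HodgeConjecture.Cruxes.H413.F0P3cDyRamDiagonalStrataDefs
open Summit.HodgeConjecture.HodgeConjecture.Cruxes.H413.F0P3cDyRamLabelledOddCountDefs
open Summit.HodgeConjecture.HodgeConjecture.Cruxes.H413.F0P3cDyRamStableSumSignClasses (normSign_eq_one_or)
open Summit.HodgeConjecture.HodgeConjecture.Cruxes.H413.F0P3cDyRamDiagonalOrbitFibreTransport (fibre_isCoset_zero)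
open Summit.HodgeConjecture.HodgeConjecture.Cruxes.H413.F0P3cDyRamDiagonalGluedStratumG3
open Summit.HodgeConjecture.HodgeConjecture.Cruxes.H413.F0P3cDyRamLabelledOddBoundaryLatticeG3 (linear_eq_sum_mul_one_add)
open Summit.HodgeConjecture.HodgeConjecture.Cruxes.H413.F0P3cDyRamLabelledOddBoundaryValueG3 (normSign_one_add_mul_mul)
open Summit.HodgeConjecture.HodgeConjecture.Cruxes.H413.F0P3cDyRamLabelledOddKappaClassLatticeG3 (twoSlotLabel_latt_G3_foot)
open Summit.HodgeConjecture.HodgeConjecture.Cruxes.H413.F0P3cDyRamValueClassLabelEquivariant (isTorusEquivariantLabel_valueClassLabel)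
open Summit.HodgeConjecture.HodgeConjecture.Cruxes.H413.F0P3cDyRamLabelledOddOneSlotRead (map_unitNormMap_unitStabilizer_le)
open Summit.HodgeConjecture.HodgeConjecture.Cruxes.H413.F0P3cDyRamLabelledOddClassSignRead (classSign_mul_eq_of_label)
open Summit.HodgeConjecture.HodgeConjecture.Cruxes.H413.F0P3cDyRamLabelledOddCharacterRead (labelledOddCount_div_relIndex_eq_of_character)
open Summit.HodgeConjecture.HodgeConjecture.Cruxes.H413.F0P3cDyRamDiagonalKappaSplitCountValues
open scoped Valued WithZero Matrix MatrixGroups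

variable {K : Type} [Field K] [Valued K ℤᵐ⁰] [CompleteSpace K] [Fintype 𝓀[K]] {σ : K →+* K} {ϖ : K} {d t : ℕ} {α β : K} {N₀ n₁ n₂ n₃ : ℕ}

open Classical in
/-- **THE G₃ κ-CLASS VALUE IN ABSTRACT-INDICATOR FORM (R6 B1′ — the FOOT clone of ★ p861675 (β1)).**  On the G₃ normal form `M₀ = latt (1 0 0; x ϖ^{ρ+s} 0; y z ϖ^{2ρ})`
(`|x| = |y| = 1`, `|z| = |ϖ|^ρ`) with polarisation `D`, `T`-stable, on the clean shell, AT THE FOOT `2k₁ + ℓ₀ = n₁ = 2ρ + ℓ₀` and BELOW THE READ `2ρ + s < 2k₃`, `2k₃ + ℓ₀ = n₃`, unit tokens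
`e_C` (of `β − α` at `k₃`), `e_B` (of `β − 1` at `k₁`): with `S = D₀(π₀^{k₁}e_B − π₀^{k₃}e_C) + D₁N(x)π₀^{k₁}e_B` (a fixed UNIT led by the Gram term `π₀^{k₁}e_B(D₀ + σxD₁x)`),
`G₁ = D₁N(x)π₀^{k₁}e_B` (`|G₁| = exp s`) and `c = G₁∕S`,
`labelledOddCount σ ϖ 0 i (valueClassLabel σ ϖ (α−1) (β−1) m* d) M₀ ∕ [𝒰 : N(S̃′(M₀))] = ω(S)·ω(D_i)∕2 · [∀ u ∈ S_F(M₀), ω(u_i)·(ω(u₀)·ω(1 + (u₁∕u₀ − 1)·c)) = 1] · stabiliserWeight σ M₀`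
— ★ p861456 HEAD A′-χ on the character `λ(u) = ω(u₀)·ω(1 + (u₁∕u₀ − 1)·c)` (multiplicative on `S_F` by ★ `normSign_one_add_mul_mul` at `r = ρ + s`: `|ϖ^r|·|c| = |ϖ|^ρ`, depth `2ρ ≥ 2d − 1`), the
label read ★ p861570 `twoSlotLabel_latt_G3_foot`, `λ ≡ 1` on `N(S̃′)` by torus-equivariance; proof = LH7-p06 (g0)'s ★ (β1) proof with the tube letters replaced by the foot letters.
[cite: Kottwitz1986BaseChangeUnits, §1 pp. 240–241] [cite: LanglandsShelstad1987, §3] [cite: Serre1979, Ch. V §3 Cor. 3] [cite: Rogawski1990, §4.9 Prop. 4.9.1 (a)(b) p. 55, §4.10 p. 58]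
[cite: Jacobowitz1962, §4, §7] -/
theorem labelledOddCount_div_relIndex_twoSlot_latt_G3_foot (hD : IsRamifiedQuadraticDatum σ ϖ d t) (h2d : 2 ≤ d)
    (hE : IsElementDatum σ ϖ N₀ α β n₁ n₂ n₃) (hmc : mcOfRecord d ≤ N₀)
    (T : GL (Fin 3) K) (hT : (T : Matrix (Fin 3) (Fin 3) K) = Matrix.diagonal ![α, β, 1])
    {ρ s : ℕ} (hρ : 1 ≤ ρ) (hs : 1 ≤ s) {x y z : K} (hx : Valued.v x = 1) (hy : Valued.v y = 1) (hz : Valued.v z = Valued.v (ϖ ^ ρ))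
    (k₃ : ℕ) (hlt : 2 * ρ + s < 2 * k₃) (hk₃ : 2 * k₃ + d % 2 = n₃) (k₁ : ℕ) (hk₁ : 2 * k₁ + d % 2 = n₁) (hfoot : 2 * ρ + d % 2 = n₁)
    {M₀ : Submodule 𝒪[K] (Fin 3 → K)} (hM₀ : M₀ = latt (!![1, 0, 0; x, ϖ ^ (ρ + s), 0; y, z, ϖ ^ (2 * ρ)] : Matrix (Fin 3) (Fin 3) K))
    (hTM : mapGL T M₀ = M₀) {D : Fin 3 → K} (hD₁ : ∀ j, σ (D j) = D j ∧ D j ≠ 0) (hV₁ : IsVertexLattice σ ϖ (Matrix.diagonal D) 0 M₀)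
    (hlev : LatticeInLevel ϖ (d % 2) (Matrix.diagonal ![α - 1, β - 1, 0]) M₀) (hnlev : ¬ LatticeInLevel ϖ (d % 2 + 1) (Matrix.diagonal ![α - 1, β - 1, 0]) M₀)
    (hsq : LatticeInLevel ϖ (mcOfRecord d) (Matrix.diagonal ![(α - 1) * (α - 1), (β - 1) * (β - 1), 0]) M₀)
    (hfin : {M : Submodule 𝒪[K] (Fin 3 → K) | ∃ u ∈ unitTorus K 3, M = mapGL (diagGLUnits u) M₀}.Finite)
    {eC : K} (hσeC : σ eC = eC) (heC1 : Valued.v eC = 1)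
    (heC : Valued.v ((ϖ ^ (d % 2 + 2 * d - 1))⁻¹ * ((β - α) * ((ϖ * σ ϖ) ^ k₃)⁻¹ - eC * ((ϖ - σ ϖ) * ((ϖ * σ ϖ) ^ ((d - d % 2) / 2))⁻¹))) ≤ 1)
    {eB : K} (hσeB : σ eB = eB) (heB1 : Valued.v eB = 1)
    (heB : Valued.v ((ϖ ^ (d % 2 + 2 * d - 1))⁻¹ * ((β - 1) * ((ϖ * σ ϖ) ^ k₁)⁻¹ - eB * ((ϖ - σ ϖ) * ((ϖ * σ ϖ) ^ ((d - d % 2) / 2))⁻¹))) ≤ 1) (i : Fin 3) :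
    (labelledOddCount σ ϖ 0 i (valueClassLabel σ ϖ (α - 1) (β - 1) (d % 2 + 2 * d - 1) d) M₀ : ℚ) /
        ((((unitStabilizer M₀).map (unitNormMap σ 3)).relIndex (fixedUnitTorus σ 3) : ℕ) : ℚ) =
      (normSign σ (D 0 * ((ϖ * σ ϖ) ^ k₁ * eB - (ϖ * σ ϖ) ^ k₃ * eC) + D 1 * (σ x * x) * ((ϖ * σ ϖ) ^ k₁ * eB)) : ℚ) * (normSign σ (D i) : ℚ) / 2 *
        ((if ∀ u ∈ fixedUnitStabilizer σ M₀,
              normSign σ ((u i : Kˣ) : K) *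
                  (normSign σ ((u 0 : Kˣ) : K) *
                    normSign σ (1 + (((u 1 : Kˣ) : K) / ((u 0 : Kˣ) : K) - 1) *
                      (D 1 * (σ x * x) * ((ϖ * σ ϖ) ^ k₁ * eB) /
                        (D 0 * ((ϖ * σ ϖ) ^ k₁ * eB - (ϖ * σ ϖ) ^ k₃ * eC) + D 1 * (σ x * x) * ((ϖ * σ ϖ) ^ k₁ * eB))))) = 1
            then 1 else 0 : ℤ) : ℚ) * stabiliserWeight σ M₀ := by
  have hD' := hD
  obtain ⟨hσ, hvσ, hϖ, -, -, hd1, -⟩ := hD'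
  haveI : IsAdicComplete 𝓂[K] 𝒪[K] := isAdicComplete_valuedInteger_of_completeSpace hϖ
  haveI : Finite 𝓀[K] := Finite.of_fintype _
  obtain ⟨cn, hσcn, hcnv, hcn, hdich⟩ := exists_nonnorm_dichotomy_of_isRamifiedQuadraticDatum σ ϖ d t hD
  have hϖ0 : ϖ ≠ 0 := fun h0 => by rw [h0, map_zero] at hϖ; exact WithZero.coe_ne_zero hϖ.symm
  have hϖ1 : Valued.v ϖ ≤ 1 := by rw [hϖ, ← WithZero.exp_zero, WithZero.exp_le_exp]; norm_num
  have hq : ∀ n : ℕ, Valued.v (ϖ ^ n) = WithZero.exp (-(n : ℤ)) := fun n => by rw [map_pow, v_varpi_pow hϖ]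
  have hN₁ : N₀ ≤ n₁ := hE.2.2.2.2.2.2.2.2.1
  have hmcv : mcOfRecord d = 2 * ((d % 2 + 2 * d - 1 + d) / 2) := rfl
  -- AT THE FOOT (★ p861570's letters): `S = G₀ + G₁ = π₀^{k₁}e_B·(D₀ + σxD₁x) − D₀π₀^{k₃}e_C` is a fixed UNIT led by the Gram term (★ `v_gram_cancel_latt_G3_eq`), `|G₁| = exp s`
  have hσϖ0 : σ ϖ ≠ 0 := (map_ne_zero σ).2 hϖ0
  have hvπ : ∀ k : ℕ, Valued.v ((ϖ * σ ϖ) ^ k) = WithZero.exp (-((2 * k : ℕ) : ℤ)) := fun k => by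
    rw [map_pow, map_mul, hvσ, ← pow_two, ← pow_mul, v_varpi_pow hϖ]
  have hV₁' := hV₁
  rw [hM₀] at hV₁'
  obtain ⟨hvD0, hvD1, -⟩ := v_polarisation_latt_G3 hvσ hϖ (fun k => (hD₁ k).2) hρ hs hx hy hz hV₁'
  have hgram := v_gram_cancel_latt_G3_eq hvσ hϖ (fun k => (hD₁ k).2) hρ hs hx hy hz hV₁'
  have hNx : Valued.v (σ x * x) = 1 := by rw [map_mul, hvσ, hx, one_mul]
  set G₁ : K := D 1 * (σ x * x) * ((ϖ * σ ϖ) ^ k₁ * eB) with hG₁def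
  set S : K := D 0 * ((ϖ * σ ϖ) ^ k₁ * eB - (ϖ * σ ϖ) ^ k₃ * eC) + G₁ with hSdef
  set c : K := G₁ / S with hcdef
  have hG1v : Valued.v G₁ = WithZero.exp ((s : ℕ) : ℤ) := by
    rw [hG₁def, map_mul, map_mul, hvD1, hNx, mul_one, map_mul, hvπ, heB1, mul_one, ← WithZero.exp_add]; congr 1; push_cast; omega
  have hS1 : Valued.v S = 1 := by
    have hsplit : S = (ϖ * σ ϖ) ^ k₁ * eB * (D 0 + σ x * D 1 * x) + -(D 0 * (ϖ * σ ϖ) ^ k₃ * eC) := by rw [hSdef, hG₁def]; ring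
    have hlead : Valued.v ((ϖ * σ ϖ) ^ k₁ * eB * (D 0 + σ x * D 1 * x)) = 1 := by
      rw [map_mul, map_mul, hvπ, heB1, mul_one, hgram, ← WithZero.exp_add, ← WithZero.exp_zero]; congr 1; push_cast; omega
    have htwist : Valued.v (-(D 0 * (ϖ * σ ϖ) ^ k₃ * eC)) < 1 := by
      rw [Valuation.map_neg, map_mul, map_mul, hvD0, hvπ, heC1, mul_one, ← WithZero.exp_add, ← WithZero.exp_zero, WithZero.exp_lt_exp]; push_cast; omega
    rw [hsplit, Valuation.map_add_eq_of_lt_left _ (by rw [hlead]; exact htwist), hlead]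

  have hS0 : S ≠ 0 := fun h => by rw [h, map_zero] at hS1; exact zero_ne_one hS1
  have hπ₀σ : σ (ϖ * σ ϖ) = ϖ * σ ϖ := by rw [map_mul, hσ, mul_comm]
  have hπσ : ∀ k : ℕ, σ ((ϖ * σ ϖ) ^ k) = (ϖ * σ ϖ) ^ k := fun k => by rw [map_pow, hπ₀σ]
  have hσG₁ : σ G₁ = G₁ := by
    rw [hG₁def]; simp only [map_mul, (hD₁ 1).1, hσ, hπσ, hσeB]; ring
  have hσS : σ S = S := by
    rw [hSdef, map_add, hσG₁, map_mul, (hD₁ 0).1, map_sub, map_mul, map_mul, hπσ, hπσ, hσeB, hσeC]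
  have hσc : σ c = c := by rw [hcdef, map_div₀, hσG₁, hσS]
  have hone : normSign σ (1 : K) = 1 := normSign_of_isNorm σ ⟨1, by rw [map_one, one_mul]⟩
  have hcv' : Valued.v c = WithZero.exp ((s : ℕ) : ℤ) := by rw [hcdef, map_div₀, hS1, div_one, hG1v]
  -- normalisation, fibre, stabiliser tube (★ p861251)
  have hzle : Valued.v z ≤ 1 := by rw [hz, hq, ← WithZero.exp_zero, WithZero.exp_le_exp]; omega
  have hnorm := isNormalisedLattice_latt_G3 hϖ1 hx hy hzle ρ s
  rw [← hM₀] at hnorm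
  have hcoset := fibre_isCoset_zero hvσ ϖ (Matrix.GeneralLinearGroup.mkOfDetNeZero _ (det_latt_G3_ne_zero hϖ0 x y z ρ s)) hM₀ hnorm _ hD₁ hV₁
  have hSF : ∀ u ∈ fixedUnitStabilizer σ M₀,
      (∀ j, Valued.v ((u j : Kˣ) : K) = 1) ∧ (∀ j, σ ((u j : Kˣ) : K) = (u j : Kˣ)) ∧
        Valued.v (((u 1 : Kˣ) : K) / ((u 0 : Kˣ) : K) - 1) ≤ Valued.v (ϖ ^ (ρ + s)) := by
    intro u hu
    obtain ⟨huv, huσ⟩ := (mem_fixedUnitTorus_iff σ u).1 (Subgroup.mem_inf.1 (show u ∈ fixedUnitStabilizer σ M₀ from hu)).2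
    have hu' := hu
    rw [hM₀] at hu'
    have h10 := (v_sub_le_of_mem_fixedUnitStabilizer_latt_G3 σ hϖ0 hϖ1 hx hz hu').1
    refine ⟨huv, huσ, ?_⟩
    rw [show ((u 1 : Kˣ) : K) / ((u 0 : Kˣ) : K) - 1 = (((u 1 : Kˣ) : K) - (u 0 : Kˣ)) / ((u 0 : Kˣ) : K) by field_simp, map_div₀, huv 0, div_one]
    exact h10
  -- the §1 depth letters for `c` at `r = ρ + s`
  -- ★ `normSign_one_add_mul_mul`'s letters at `r = ρ + s`: `|ϖ^{ρ+s}|·|c| = |ϖ|^ρ < 1`, and the DEPTH CONDITION reads `2ρ ≥ 2d − 1` at the foot (`2ρ + ℓ₀ = n₁ ≥ N₀ ≥ mcOfRecord d`)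
  have hsmall : Valued.v (ϖ ^ (ρ + s)) * Valued.v c < 1 := by
    rw [hq, hcv', ← WithZero.exp_add, ← WithZero.exp_zero, WithZero.exp_lt_exp]; push_cast; omega
  have hdepth : Valued.v (ϖ ^ (ρ + s)) * Valued.v (ϖ ^ (ρ + s)) * Valued.v c * max (Valued.v c) 1 ≤ Valued.v ϖ ^ (2 * d - 1) := by
    have hc1 : 1 ≤ Valued.v c := by rw [hcv', ← WithZero.exp_zero, WithZero.exp_le_exp]; positivity
    rw [max_eq_left hc1, hcv', hq, v_varpi_pow hϖ, ← WithZero.exp_add, ← WithZero.exp_add, ← WithZero.exp_add, WithZero.exp_le_exp]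
    rw [hmcv] at hmc
    push_cast; omega

  -- THE CHARACTER `λ(u) = ω(u₀)·ω(1 + (u₁∕u₀ − 1)·c)`: ±1-valued, multiplicative, the label reads `ω(S)·λ(u) = 1`, trivial on `N′`
  have hval : ∀ u ∈ fixedUnitStabilizer σ M₀,
      normSign σ ((u 0 : Kˣ) : K) * normSign σ (1 + (((u 1 : Kˣ) : K) / ((u 0 : Kˣ) : K) - 1) * c) = 1 ∨
        normSign σ ((u 0 : Kˣ) : K) * normSign σ (1 + (((u 1 : Kˣ) : K) / ((u 0 : Kˣ) : K) - 1) * c) = -1 := by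
    intro u _
    rcases normSign_eq_one_or σ ((u 0 : Kˣ) : K) with h0 | h0 <;>
      rcases normSign_eq_one_or σ (1 + (((u 1 : Kˣ) : K) / ((u 0 : Kˣ) : K) - 1) * c) with h1 | h1 <;> simp [h0, h1]
  have hΛ : ∀ u ∈ fixedUnitStabilizer σ M₀,
      valueClassLabel σ ϖ (α - 1) (β - 1) (d % 2 + 2 * d - 1) d M₀ (fun k => D k * ((u k : Kˣ) : K)) ↔
        normSign σ S * (normSign σ ((u 0 : Kˣ) : K) * normSign σ (1 + (((u 1 : Kˣ) : K) / ((u 0 : Kˣ) : K) - 1) * c)) = 1 := by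
    intro u hu
    obtain ⟨huv, huσ, h10⟩ := hSF u hu
    have hread := twoSlotLabel_latt_G3_foot hD h2d hE hmc T hT hρ hs hx hy hz k₃ hlt hk₃ k₁ hk₁ hfoot hM₀ hTM hD₁ hV₁ hlev hnlev hsq hσeC heC hσeB heB u hu
    have hlin : ((u 0 : Kˣ) : K) * (D 0 * ((ϖ * σ ϖ) ^ k₁ * eB - (ϖ * σ ϖ) ^ k₃ * eC)) + ((u 1 : Kˣ) : K) * G₁ =
        S * ((u 0 : Kˣ) : K) * (1 + (((u 1 : Kˣ) : K) / ((u 0 : Kˣ) : K) - 1) * c) :=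
      linear_eq_sum_mul_one_add (u 0).ne_zero hS0
    rw [hread, hlin]
    -- `w = 1 + (u₁∕u₀ − 1)·c` is a fixed unit
    have hwv : Valued.v ((((u 1 : Kˣ) : K) / ((u 0 : Kˣ) : K) - 1) * c) < 1 := by
      rw [map_mul]; exact (mul_le_mul' h10 le_rfl).trans_lt hsmall
    have hw1 : Valued.v (1 + (((u 1 : Kˣ) : K) / ((u 0 : Kˣ) : K) - 1) * c) = 1 := Valued.v.map_one_add_of_lt hwv
    have hw0 : 1 + (((u 1 : Kˣ) : K) / ((u 0 : Kˣ) : K) - 1) * c ≠ 0 := fun h => by rw [h, map_zero] at hw1; exact zero_ne_one hw1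
    have hσw : σ (1 + (((u 1 : Kˣ) : K) / ((u 0 : Kˣ) : K) - 1) * c) = 1 + (((u 1 : Kˣ) : K) / ((u 0 : Kˣ) : K) - 1) * c := by
      rw [map_add, map_one, map_mul, map_sub, map_div₀, huσ 1, huσ 0, map_one, hσc]
    have hσSu : σ (S * ((u 0 : Kˣ) : K)) = S * ((u 0 : Kˣ) : K) := by rw [map_mul, hσS, huσ 0]
    rw [normSign_mul_of_fixed hD hσSu hσw (mul_ne_zero hS0 (u 0).ne_zero) hw0, normSign_mul_of_fixed hD hσS (huσ 0) hS0 (u 0).ne_zero, mul_assoc]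
  have hmul : ∀ u ∈ fixedUnitStabilizer σ M₀, ∀ u' ∈ fixedUnitStabilizer σ M₀,
      normSign σ (((u * u') 0 : Kˣ) : K) * normSign σ (1 + ((((u * u') 1 : Kˣ) : K) / (((u * u') 0 : Kˣ) : K) - 1) * c) =
        (normSign σ ((u 0 : Kˣ) : K) * normSign σ (1 + (((u 1 : Kˣ) : K) / ((u 0 : Kˣ) : K) - 1) * c)) *
          (normSign σ ((u' 0 : Kˣ) : K) * normSign σ (1 + (((u' 1 : Kˣ) : K) / ((u' 0 : Kˣ) : K) - 1) * c)) := by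
    intro u hu u' hu'
    obtain ⟨huv, huσ, h10⟩ := hSF u hu
    obtain ⟨huv', huσ', h10'⟩ := hSF u' hu'
    have e0 : (((u * u') 0 : Kˣ) : K) = ((u 0 : Kˣ) : K) * ((u' 0 : Kˣ) : K) := by rw [Pi.mul_apply, Units.val_mul]
    have e1 : (((u * u') 1 : Kˣ) : K) / (((u * u') 0 : Kˣ) : K) = (((u 1 : Kˣ) : K) / ((u 0 : Kˣ) : K)) * (((u' 1 : Kˣ) : K) / ((u' 0 : Kˣ) : K)) := by
      rw [Pi.mul_apply, Pi.mul_apply, Units.val_mul, Units.val_mul]; field_simp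
    have hσt : σ (((u 1 : Kˣ) : K) / ((u 0 : Kˣ) : K)) = ((u 1 : Kˣ) : K) / ((u 0 : Kˣ) : K) := by rw [map_div₀, huσ 1, huσ 0]
    have hσt' : σ (((u' 1 : Kˣ) : K) / ((u' 0 : Kˣ) : K)) = ((u' 1 : Kˣ) : K) / ((u' 0 : Kˣ) : K) := by rw [map_div₀, huσ' 1, huσ' 0]
    rw [e1, e0, normSign_mul_of_fixed hD (huσ 0) (huσ' 0) (u 0).ne_zero (u' 0).ne_zero,
      normSign_one_add_mul_mul hD hσc (r := ρ + s) (by omega) hsmall hdepth hσt hσt' h10 h10']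
    ring
  -- `N′ ≤ S_F` and `λ ≡ 1` on `N′` (torus-equivariance of the value-class label)
  have hNS := map_unitNormMap_unitStabilizer_le σ hσ ϖ 0 hD₁ hV₁ hcoset
  have hε : (normSign σ S : ℤ) = 1 ∨ (normSign σ S : ℤ) = -1 := normSign_eq_one_or σ S
  have hval' : ∀ u ∈ fixedUnitStabilizer σ M₀,
      normSign σ S * (normSign σ ((u 0 : Kˣ) : K) * normSign σ (1 + (((u 1 : Kˣ) : K) / ((u 0 : Kˣ) : K) - 1) * c)) = 1 ∨
        normSign σ S * (normSign σ ((u 0 : Kˣ) : K) * normSign σ (1 + (((u 1 : Kˣ) : K) / ((u 0 : Kˣ) : K) - 1) * c)) = -1 := by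
    intro u hu
    rcases hε with h0 | h0 <;> rcases hval u hu with h1 | h1 <;> simp [h0, h1]
  have hN : ∀ n ∈ (unitStabilizer M₀).map (unitNormMap σ 3),
      normSign σ ((n 0 : Kˣ) : K) * normSign σ (1 + (((n 1 : Kˣ) : K) / ((n 0 : Kˣ) : K) - 1) * c) = 1 := by
    intro n hn
    have key := classSign_mul_eq_of_label (D₁ := D) (isTorusEquivariantLabel_valueClassLabel σ ϖ (α - 1) (β - 1) (d % 2 + 2 * d - 1) d) hNS
      (lam := fun u => normSign σ S * (normSign σ ((u 0 : Kˣ) : K) * normSign σ (1 + (((u 1 : Kˣ) : K) / ((u 0 : Kˣ) : K) - 1) * c)))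
      hval' hΛ (one_mem _) hn
    have h1 : normSign σ (((1 : Fin 3 → Kˣ) 0 : Kˣ) : K) * normSign σ (1 + ((((1 : Fin 3 → Kˣ) 1 : Kˣ) : K) / (((1 : Fin 3 → Kˣ) 0 : Kˣ) : K) - 1) * c) = 1 := by
      simp only [Pi.one_apply, Units.val_one, div_one, sub_self, zero_mul, add_zero, hone, mul_one]
    simp only [one_mul] at key
    rw [h1, mul_one] at key
    rcases hε with h0 | h0
    · rw [h0, one_mul] at key; exact key
    · rw [h0, neg_one_mul, neg_eq_iff_eq_neg] at key
      rcases hval n (hNS hn) with h | h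
      · exact h
      · rw [h] at key; norm_num at key
  exact labelledOddCount_div_relIndex_eq_of_character hσ hvσ hσcn hcnv hcn hdich hfin hD₁ hV₁ hcoset
    (valueClassLabel σ ϖ (α - 1) (β - 1) (d % 2 + 2 * d - 1) d) i hε hmul hval hN hΛ

end Summit.HodgeConjecture.HodgeConjecture.Cruxes.H413.F0P3cDyRamLabelledOddKappaClassValueG3

end
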